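import Mathlib
import Summits.KontsevichZagierPeriods.KontsevichZagierPeriods.Theorems.ZagierDilogarithmConjecture.Negative.DehnInvariant
import Summits.KontsevichZagierPeriods.KontsevichZagierPeriods.Theorems.ZagierDilogarithmConjecture.Negative.DehnWitness
import HarnessLib

/-!
# `ZagierDilogarithmConjecture` (stmt-KontsevichZagierPeriods-10550) — line `kummer-clausen-linearisation`
# (c5 cycle 4, "the Gaussian exceptional-unit sector"), stub `stub_gsecChars`: valuation characters at `1+i`, `2+i`, `2−i`

**Valuation characters at the Gaussian primes over `2` and `5`.** There are additive characters
`u, v, w : ℂˣ → ℚ` (read on `ℂ` through `ext`, which is `0` at `0`) with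

* `u(1+i) = 1`, `u(2+i) = u(2−i) = 0`;
* `v(2+i) = 1`, `v(1+i) = v(2−i) = 0`;
* `w(2−i) = 1`, `w(1+i) = w(2+i) = 0`.

They are the `ℚ`-valued "valuations" at `ρ = 1+i`, `π = 2+i`, `π̄ = 2−i` through which the Dehn-type
invariant `dehn` of `Negative.DehnInvariant` is read on the exceptional units of `ℤ[i, 1/10]`.

**Proof.** In `X = Additive ℂˣ` the three elements `x_ρ, x_π, x_π̄` are `ℤ`-independent
(`GaussSectorChars.indep`): a relation `a • x_ρ + b • x_π + c • x_π̄ = 0` reads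
`(1+i)^a (2+i)^b (2−i)^c = 1` in `ℂ`; taking `Complex.normSq` gives `2^a 5^b 5^c = 1` in `ℚ`, whose
`2`-adic and `5`-adic valuations (`padicValRat`) give `a = 0` and `b + c = 0`; then
`((2+i)/(2−i))^b = 1` forces `b = 0` because `q = (2+i)/(2−i)` is not a root of unity
(`DehnWitness.q_zpow_eq_one`, coprimality of `2 ± i` in `ℤ[i]`). Each character is then obtained from
the three-element extension lemma `GaussSectorChars.exists_addMonoidHom_eq_one_eq_zero_eq_zero`
(prescribe `1` on `x₀` and kill `x₁, x₂`: define the map on the line through the image of `x₀` in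
`X ⧸ (ℤx₁ + ℤx₂)` and extend by the injectivity of the divisible group `ℚ`, `Module.Baer.of_divisible`
— the two-element version is `Negative.DehnInvariant.exists_addMonoidHom_eq_one_eq_zero`), applied
three times with the roles permuted (`GaussSectorChars.exists_three`).
Sorry-free; axioms ⊆ {propext, Classical.choice, Quot.sound}. No new definitions.

## References

* J. L. Dupont, C.-H. Sah, *Scissors congruences II*, J. Pure Appl. Algebra 25 (1982), §4 (Dehn
  invariants of the Bloch group read through additive characters). Standard algebra otherwise.
-/

noncomputable section

open Complex
open Summit.KontsevichZagierPeriods.HyperbolicBloch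

namespace Summit.KontsevichZagierPeriods.HyperbolicBloch.ZagierDilogarithmCertificate

open _root_.Summit.KontsevichZagierPeriods.HyperbolicBloch.ZagierDilogarithmConjectureNegative
  (ext_of_ne two_add_I_ne_zero two_sub_I_ne_zero q_zpow_eq_one)

namespace GaussSectorChars

/-- **Extension lemma, one prescribed value and two killed elements.** If no relation
`a • x₀ + b • x₁ + c • x₂ = 0` in the abelian group `X` has `a ≠ 0`, there is an additive map
`φ : X → ℚ` with `φ x₀ = 1`, `φ x₁ = 0`, `φ x₂ = 0`: define it on the line through the image of
`x₀` in `X ⧸ (ℤx₁ + ℤx₂)` and extend by the injectivity of the divisible group `ℚ`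
(`Module.Baer.of_divisible`). [folklore] -/
theorem exists_addMonoidHom_eq_one_eq_zero_eq_zero {X : Type*} [AddCommGroup X] (x₀ x₁ x₂ : X)
    (hx : ∀ a b c : ℤ, a • x₀ + b • x₁ + c • x₂ = 0 → a = 0) :
    ∃ φ : X →+ ℚ, φ x₀ = 1 ∧ φ x₁ = 0 ∧ φ x₂ = 0 := by
  let N : Submodule ℤ X := Submodule.span ℤ {x₁, x₂}
  have hx' : ∀ M : ℤ, M • x₀ ∈ N → M = 0 := by
    intro M hM
    obtain ⟨b, c, hbc⟩ := Submodule.mem_span_pair.mp hM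
    refine hx M (-b) (-c) ?_
    rw [neg_smul, neg_smul, ← hbc]
    abel
  have H : ∀ c : ℤ, c • (N.mkQ x₀) = 0 → (RingHom.id ℤ) c • (1 : ℚ) = 0 := by
    intro c hc
    have hc' : N.mkQ (c • x₀) = 0 := by rw [map_zsmul]; exact hc
    rw [Submodule.mkQ_apply, Submodule.Quotient.mk_eq_zero] at hc'
    rw [hx' c hc', RingHom.id_apply, zero_smul]
  have hmem : N.mkQ x₀ ∈ (LinearPMap.mkSpanSingleton' (N.mkQ x₀) (1 : ℚ) H).domain :=
    Submodule.mem_span_singleton_self _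
  obtain ⟨ψ, hψ⟩ := (Module.Baer.of_divisible ℚ).extension_property _
    (LinearPMap.mkSpanSingleton' (N.mkQ x₀) (1 : ℚ) H).domain.injective_subtype
    (LinearPMap.mkSpanSingleton' (N.mkQ x₀) (1 : ℚ) H).toFun
  have kill : ∀ y ∈ ({x₁, x₂} : Set X), (ψ ∘ₗ N.mkQ).toAddMonoidHom y = 0 := by
    intro y hy
    change ψ (N.mkQ y) = 0
    rw [Submodule.mkQ_apply, (Submodule.Quotient.mk_eq_zero N).2 (Submodule.subset_span hy),
      map_zero]
  refine ⟨(ψ ∘ₗ N.mkQ).toAddMonoidHom, ?_, kill x₁ (by simp), kill x₂ (by simp)⟩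
  change ψ (N.mkQ x₀) = 1
  have e := DFunLike.congr_fun hψ ⟨N.mkQ x₀, hmem⟩
  rw [LinearMap.comp_apply, Submodule.subtype_apply] at e
  rw [e]
  exact LinearPMap.mkSpanSingleton'_apply_self _ (1 : ℚ) H hmem

/-- **Three characters from full independence.** If `x₀, x₁, x₂` are `ℤ`-independent in the abelian
group `X`, there are additive maps `u, v, w : X → ℚ` forming the dual "basis": `u = (1, 0, 0)`,
`v = (0, 1, 0)`, `w = (0, 0, 1)` on `(x₀, x₁, x₂)` (the one-prescribed-value lemma applied three
times with the roles permuted). [folklore] -/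
theorem exists_three {X : Type*} [AddCommGroup X] (x₀ x₁ x₂ : X)
    (hx : ∀ a b c : ℤ, a • x₀ + b • x₁ + c • x₂ = 0 → a = 0 ∧ b = 0 ∧ c = 0) :
    ∃ u v w : X →+ ℚ,
      u x₀ = 1 ∧ u x₁ = 0 ∧ u x₂ = 0 ∧ v x₀ = 0 ∧ v x₁ = 1 ∧ v x₂ = 0 ∧
        w x₀ = 0 ∧ w x₁ = 0 ∧ w x₂ = 1 := by
  obtain ⟨u, hu0, hu1, hu2⟩ :=
    exists_addMonoidHom_eq_one_eq_zero_eq_zero x₀ x₁ x₂ fun a b c h => (hx a b c h).1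
  obtain ⟨v, hv1, hv0, hv2⟩ :=
    exists_addMonoidHom_eq_one_eq_zero_eq_zero x₁ x₀ x₂ fun a b c h =>
      (hx b a c (by rw [← h]; abel)).2.1
  obtain ⟨w, hw2, hw0, hw1⟩ :=
    exists_addMonoidHom_eq_one_eq_zero_eq_zero x₂ x₀ x₁ fun a b c h =>
      (hx b c a (by rw [← h]; abel)).2.2
  exact ⟨u, v, w, hu0, hu1, hu2, hv0, hv1, hv2, hw0, hw1, hw2⟩

/-- Reading a three-term additive relation in `Additive ℂˣ` as a multiplicative one in `ℂ`:
`a • [x] + b • [y] + c • [z] = 0` gives `x ^ a * y ^ b * z ^ c = 1`. [folklore] -/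
theorem zpow_mul_zpow_mul_zpow_eq_one_of_smul {x y z : ℂ} (hx : x ≠ 0) (hy : y ≠ 0) (hz : z ≠ 0)
    {a b c : ℤ}
    (H : a • Additive.ofMul (Units.mk0 x hx) + b • Additive.ofMul (Units.mk0 y hy) +
        c • Additive.ofMul (Units.mk0 z hz) = 0) :
    x ^ a * y ^ b * z ^ c = 1 := by
  have e := congrArg (fun t : Additive ℂˣ => ((Additive.toMul t : ℂˣ) : ℂ)) H
  simpa [toMul_add, toMul_zsmul, Units.val_zpow_eq_zpow_val] using e

/-- `|1 + i|² = 2`. [folklore] -/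
theorem normSq_one_add_I : Complex.normSq (1 + I) = 2 := by norm_num [Complex.normSq_apply]

/-- `|2 + i|² = 5`. [folklore] -/
theorem normSq_two_add_I : Complex.normSq (2 + I) = 5 := by norm_num [Complex.normSq_apply]

/-- `|2 − i|² = 5`. [folklore] -/
theorem normSq_two_sub_I : Complex.normSq (2 - I) = 5 := by norm_num [Complex.normSq_apply]

/-- `2`-adic and `5`-adic valuations: `2 ^ a * 5 ^ b * 5 ^ c = 1` in `ℚ` (`a b c : ℤ`) forces `a = 0`
and `b + c = 0`. [folklore] -/
theorem exponents_eq_zero_of_two_five {a b c : ℤ} (h : (2 : ℚ) ^ a * 5 ^ b * 5 ^ c = 1) :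
    a = 0 ∧ b + c = 0 := by
  have h2 : (2 : ℚ) ^ a ≠ 0 := zpow_ne_zero _ two_ne_zero
  have h5b : (5 : ℚ) ^ b ≠ 0 := zpow_ne_zero _ (by norm_num)
  have h5c : (5 : ℚ) ^ c ≠ 0 := zpow_ne_zero _ (by norm_num)
  have v2_5 : padicValRat 2 (5 : ℚ) = 0 := by
    have e := @padicValRat.of_nat 2 5
    rw [padicValNat.eq_zero_of_not_dvd (by norm_num)] at e
    simpa using e
  have v5_2 : padicValRat 5 (2 : ℚ) = 0 := by
    have e := @padicValRat.of_nat 5 2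
    rw [padicValNat.eq_zero_of_not_dvd (by norm_num)] at e
    simpa using e
  have v2_2 : padicValRat 2 (2 : ℚ) = 1 := by simpa using padicValRat.self (p := 2) one_lt_two
  have v5_5 : padicValRat 5 (5 : ℚ) = 1 := by
    simpa using padicValRat.self (p := 5) (by norm_num)
  constructor
  · haveI : Fact (Nat.Prime 2) := ⟨Nat.prime_two⟩
    have e := congrArg (padicValRat 2) h
    rw [padicValRat.mul (mul_ne_zero h2 h5b) h5c, padicValRat.mul h2 h5b, padicValRat.zpow,
      padicValRat.zpow, padicValRat.zpow, v2_2, v2_5, padicValRat.one] at e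
    simpa using e
  · haveI : Fact (Nat.Prime 5) := ⟨Nat.prime_five⟩
    have e := congrArg (padicValRat 5) h
    rw [padicValRat.mul (mul_ne_zero h2 h5b) h5c, padicValRat.mul h2 h5b, padicValRat.zpow,
      padicValRat.zpow, padicValRat.zpow, v5_2, v5_5, padicValRat.one] at e
    simpa [← add_mul] using e

/-- **Multiplicative independence of `1+i`, `2+i`, `2−i` in `ℂˣ`.** If
`(1+i)^a (2+i)^b (2−i)^c = 1` (`a b c : ℤ`) then `a = b = c = 0`: norms give `2^a 5^{b+c} = 1`, so
`a = 0`, `c = −b`, and then `((2+i)/(2−i))^b = 1` forces `b = 0` (`q = (2+i)/(2−i)` is not a root of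
unity, `DehnWitness.q_zpow_eq_one`). [folklore] -/
theorem indep {a b c : ℤ} (h : (1 + I) ^ a * (2 + I) ^ b * (2 - I) ^ c = 1) :
    a = 0 ∧ b = 0 ∧ c = 0 := by
  have hn := congrArg Complex.normSq h
  simp only [map_mul, map_zpow₀, map_one, normSq_one_add_I, normSq_two_add_I,
    normSq_two_sub_I] at hn
  have hq : (2 : ℚ) ^ a * 5 ^ b * 5 ^ c = 1 := by
    have e : (((2 : ℚ) ^ a * 5 ^ b * 5 ^ c : ℚ) : ℝ) = (1 : ℚ) := by push_cast; exact hn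
    exact_mod_cast e
  obtain ⟨ha, hbc⟩ := exponents_eq_zero_of_two_five hq
  subst ha
  obtain rfl : c = -b := by omega
  rw [zpow_zero, one_mul, zpow_neg, ← div_eq_mul_inv, ← div_zpow] at h
  have hb : b = 0 := q_zpow_eq_one h
  subst hb
  exact ⟨rfl, rfl, neg_zero⟩

end GaussSectorChars

open GaussSectorChars

/-- **Stub `stub_gsecChars` (c5 cycle 4): valuation characters at the Gaussian primes over `2` and
`5`.** There are additive characters `u, v, w : ℂˣ → ℚ` with `u(1+i) = 1, u(2±i) = 0`,
`v(2+i) = 1, v(1+i) = v(2−i) = 0`, `w(2−i) = 1, w(1+i) = w(2+i) = 0` (`ext` = the character read on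
`ℂ`, `0` at `0`): extend from the free subgroup `⟨1+i, 2+i, 2−i⟩` of `ℂˣ` (independent: norms
`2, 5, 5` and `((2+i)/(2−i))^b = 1 ⇒ b = 0`, `GaussSectorChars.indep`) by the injectivity of `ℚ`
(`GaussSectorChars.exists_three`). [folklore] -/
theorem stub_gsecChars :
    ∃ u v w : Additive ℂˣ →+ ℚ,
      ZagierDilogarithmConjectureNegative.ext u (1 + Complex.I) = 1 ∧ ZagierDilogarithmConjectureNegative.ext u (2 + Complex.I) = 0 ∧ ZagierDilogarithmConjectureNegative.ext u (2 - Complex.I) = 0 ∧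
      ZagierDilogarithmConjectureNegative.ext v (1 + Complex.I) = 0 ∧ ZagierDilogarithmConjectureNegative.ext v (2 + Complex.I) = 1 ∧ ZagierDilogarithmConjectureNegative.ext v (2 - Complex.I) = 0 ∧
      ZagierDilogarithmConjectureNegative.ext w (1 + Complex.I) = 0 ∧ ZagierDilogarithmConjectureNegative.ext w (2 + Complex.I) = 0 ∧ ZagierDilogarithmConjectureNegative.ext w (2 - Complex.I) = 1 := by
  -- `1 + i ≠ 0` (kept local: the named fact is `Literature.Analysis.Complex.one_add_I_ne_zero`)
  have h1 : (1 + I : ℂ) ≠ 0 := fun e => by simpa using congrArg Complex.re e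
  obtain ⟨u, v, w, hu0, hu1, hu2, hv0, hv1, hv2, hw0, hw1, hw2⟩ :=
    exists_three (Additive.ofMul (Units.mk0 (1 + I) h1))
      (Additive.ofMul (Units.mk0 (2 + I) two_add_I_ne_zero))
      (Additive.ofMul (Units.mk0 (2 - I) two_sub_I_ne_zero)) fun _ _ _ H =>
      indep (zpow_mul_zpow_mul_zpow_eq_one_of_smul _ _ _ H)
  refine ⟨u, v, w, ?_, ?_, ?_, ?_, ?_, ?_, ?_, ?_, ?_⟩
  · rw [ext_of_ne u h1]; exact hu0
  · rw [ext_of_ne u two_add_I_ne_zero]; exact hu1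
  · rw [ext_of_ne u two_sub_I_ne_zero]; exact hu2
  · rw [ext_of_ne v h1]; exact hv0
  · rw [ext_of_ne v two_add_I_ne_zero]; exact hv1
  · rw [ext_of_ne v two_sub_I_ne_zero]; exact hv2
  · rw [ext_of_ne w h1]; exact hw0
  · rw [ext_of_ne w two_add_I_ne_zero]; exact hw1
  · rw [ext_of_ne w two_sub_I_ne_zero]; exact hw2

end Summit.KontsevichZagierPeriods.HyperbolicBloch.ZagierDilogarithmCertificate

end
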